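import Literature.NumberTheory.Automorphic.UnitaryGroupRestrictedProduct
import Literature.NumberTheory.Automorphic.AdicCompletionLocalField
import Literature.NumberTheory.Automorphic.AdelicSecondCountable
import Literature.NumberTheory.Automorphic.UnitaryGroupAdelicProductHaar
import Summits.HodgeConjecture.HodgeCM.PerL34.RestrictedMeasureBorel_2
import Summits.HodgeConjecture.HodgeCM.PerL34.AdelicFactorisation
import HarnessLib

/-!
# P4-S4′(ii) (F1)+(F3): EULER FACTORISATION of integrals over `U(J)(𝔸_{F,f}) = ∏'_v U(J)(F_v)` for pure-tensor integrands

Topic: summit `HodgeConjecture`, sub-problem `HodgeConjecture`, crux H413 (stmt-HodgeConjecture-24833), FLOOR-0 P4, stub S4′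
`stub_T3a_holThetaRealisationOfRallisAt`, non-vanishing half (seat (ii)), memo `F0/P4/SEAT-ii-MEMO-S4ii.v1` §1 (F1)+(F3).
Namespace `Summit.HodgeConjecture.HodgeConjecture.Cruxes.H413.ThetaNonvanishing`.  KERNEL: theorems only.

After ★ `ThetaNonvanishing.thetaLift_charCM_tmul_ne_zero_of_finCoeff_ne_zero` (`Theorems/H413ThetaPairRepArchFinFactorisation`) the
non-vanishing of `Θ_{Φ_∞ ⊗ Φ_f}(χ̃)` needs ONE non-zero FINITE-adelic Fourier coefficient `∫_{U(W)(𝔸_f)} ⟨ω_f(b)Φ_f, Ψ_f⟩ w_f(b) db`.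
[Li1992, Thm 2.1 (27) p. 184] computes such integrals for factorizable data as EULER PRODUCTS over the finite places.  This file supplies
the measure-theoretic half of that sentence for the tree's carrier `UnitaryGroup.finAdelic F E c N J`, by JUNCTION of
★ `UnitaryGroup.finAdelicEquiv : U(J)(𝔸_{F,f}) ≃ₜ* Πʳ_v [U(J)(F_v), U(J)(𝒪_v)]` (`UnitaryGroupRestrictedProduct`) with the restricted-product
measure engine of the HodgeCM∕PerL34 package (★ `HodgeCM.PerL34.RestrictedMeasure.*`, `…AdelicFactorisation.RestrictedProductMeasureDatum`,
Leahy Prop. 3.1.8–3.1.9 ∕ Tate Thm 3.3.1 as kernel theorems):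

* §1 `locallyCompactSpace_localPi` ∕ `secondCountableTopology_localPi` — the local groups `U(J)(F_v)` (★ `UnitaryGroup.localPi`, closed in
  `Π_{w∣v} GL_N(E_w)`) are locally compact and second countable (`GL_N` of a local field: closed embedding `g ↦ (g, g⁻¹)` into
  `M_N × M_Nᵐᵒᵖ`);
* §2 **`exists_integral_finAdelic_eq_tprod`** — for ANY Haar measure `μ_f` on `U(J)(𝔸_{F,f})` and local Haar measures `ν_v` with
  `ν_v(U(J)(𝒪_v)) = 1` off a finite `S₀ ∋ i₀` there is ONE constant `κ > 0` (the Haar normalisation of `(finAdelicEquiv)_* μ_f` against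
  `⊗' ν_v`, ★ `RestrictedProductMeasureDatum.ofLeftInvariant`, absorbed at the place `i₀`) such that for every integrand `f` on
  `U(J)(𝔸_{F,f})` whose transport is a PURE TENSOR off `T` (`f(finAdelicEquiv⁻¹(glue_S(x, k))) = ∏_{v∈S} f_v(x_v)` on every level `S ⊇ T`),
  with integrable local factors and bounded partial products of `∫‖f_v‖`,
  **`∫_{U(J)(𝔸_{F,f})} f dμ_f = ∏'_v ∫_{U(J)(F_v)} f_v d(ν rescaled at i₀ by κ)_v`** — the `v ∤ ∞` half of (27).
What is NOT here: the pure-tensor structure of the Weil matrix coefficient `b ↦ ⟨finPairRep(1,b)(⊗Φ_v), ⊗Ψ_v⟩ conj χ_W(b)` ((F2): ★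
`FiniteAdeleSchwartzBruhatTensor`, `FiniteAdelicSplittingAssembly`) and the local factors ((F4), [Li1992, §5]).
HC_CM is proved only modulo the printed citations until rung 0 closes; this file proves nothing printed.

## References
* [Li1992] J.-S. Li, J. reine angew. Math. 428 (1992), Thm 2.1 (27) p. 184.
* [TateThesis1967] J. Tate, in Cassels–Fröhlich (1967), Thm 3.3.1 (restricted direct integration).
* [PlatonovRapinchuk1994] V. Platonov, A. Rapinchuk (1994), §5.1.
-/

set_option autoImplicit false
set_option linter.dupNamespace false

noncomputable section

open _root_.MeasureTheory NumberField IsDedekindDomain Topology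
open scoped RestrictedProduct NNReal ENNReal Classical
open Literature.NumberTheory.Automorphic
open HodgeCM.PerL34 HodgeCM.PerL34.AdelicFactorisation HodgeCM.PerL34.AdelicFactorisation.RestrictedProductMeasureDatum

namespace Summit.HodgeConjecture.HodgeConjecture.Cruxes.H413.ThetaNonvanishing

variable (F E : Type) [Field F] [NumberField F] [Field E] [NumberField E] [Algebra F E]
  (c : E ≃ₐ[F] E) (N : ℕ) (J : Matrix (Fin N) (Fin N) E)

/-! ## §1 The local groups `U(J)(F_v)` are locally compact and second countable -/

/-- `GL_N(E_w)` is locally compact (closed embedding `g ↦ (g, g⁻¹)` into `M_N(E_w) × M_N(E_w)ᵐᵒᵖ`, `E_w` locally compact).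
[cite: PlatonovRapinchuk1994, §5.1] -/
theorem locallyCompactSpace_gl_adicCompletion (w : HeightOneSpectrum (𝓞 E)) :
    LocallyCompactSpace (GL (Fin N) (w.adicCompletion E)) := by
  haveI : LocallyCompactSpace (Matrix (Fin N) (Fin N) (w.adicCompletion E)) :=
    inferInstanceAs (LocallyCompactSpace (Fin N → Fin N → w.adicCompletion E))
  haveI : LocallyCompactSpace (Matrix (Fin N) (Fin N) (w.adicCompletion E))ᵐᵒᵖ :=
    MulOpposite.opHomeomorph.symm.isClosedEmbedding.locallyCompactSpace
  exact Units.isClosedEmbedding_embedProduct.locallyCompactSpace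

/-- `GL_N(E_w)` is second countable. [cite: PlatonovRapinchuk1994, §5.1] -/
theorem secondCountableTopology_gl_adicCompletion (w : HeightOneSpectrum (𝓞 E)) :
    SecondCountableTopology (GL (Fin N) (w.adicCompletion E)) := by
  haveI := secondCountableTopology_adicCompletion E w
  haveI : SecondCountableTopology (Matrix (Fin N) (Fin N) (w.adicCompletion E)) :=
    inferInstanceAs (SecondCountableTopology (Fin N → Fin N → w.adicCompletion E))
  haveI : SecondCountableTopology (Matrix (Fin N) (Fin N) (w.adicCompletion E))ᵐᵒᵖ :=
    MulOpposite.opHomeomorph.symm.isEmbedding.secondCountableTopology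
  exact Units.isEmbedding_embedProduct.secondCountableTopology

/-- **`U(J)(F_v)` is locally compact** (closed in `Π_{w∣v} GL_N(E_w)`, ★ `isClosed_localPi`). [cite: PlatonovRapinchuk1994, §5.1] -/
theorem locallyCompactSpace_localPi (v : HeightOneSpectrum (𝓞 F)) : LocallyCompactSpace (UnitaryGroup.localPi E c N J v) := by
  haveI : ∀ w : UnitaryGroup.PlacesOver E v, LocallyCompactSpace (GL (Fin N) (w.1.adicCompletion E)) :=
    fun w => locallyCompactSpace_gl_adicCompletion E N w.1
  haveI : LocallyCompactSpace (UnitaryGroup.LocalGLPi E N v) := inferInstance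
  exact (UnitaryGroup.isClosed_localPi E c N J v).isClosedEmbedding_subtypeVal.locallyCompactSpace

/-- **`U(J)(F_v)` is second countable.** [cite: PlatonovRapinchuk1994, §5.1] -/
theorem secondCountableTopology_localPi (v : HeightOneSpectrum (𝓞 F)) :
    SecondCountableTopology (UnitaryGroup.localPi E c N J v) := by
  haveI : ∀ w : UnitaryGroup.PlacesOver E v, SecondCountableTopology (GL (Fin N) (w.1.adicCompletion E)) :=
    fun w => secondCountableTopology_gl_adicCompletion E N w.1
  haveI : SecondCountableTopology (UnitaryGroup.LocalGLPi E N v) := inferInstance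
  exact TopologicalSpace.Subtype.secondCountableTopology _

/-! ## §2 The Euler factorisation over `U(J)(𝔸_{F,f})` -/

section Datum

variable [∀ v : HeightOneSpectrum (𝓞 F), MeasurableSpace (UnitaryGroup.localPi E c N J v)]
  [∀ v : HeightOneSpectrum (𝓞 F), BorelSpace (UnitaryGroup.localPi E c N J v)]
  [MeasurableSpace (UnitaryGroup.finAdelic F E c N J)] [BorelSpace (UnitaryGroup.finAdelic F E c N J)]
  (μf : Measure (UnitaryGroup.finAdelic F E c N J)) [μf.IsHaarMeasure]
  (ν : ∀ v : HeightOneSpectrum (𝓞 F), Measure (UnitaryGroup.localPi E c N J v))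
  [∀ v, (ν v).IsHaarMeasure] [∀ v, SigmaFinite (ν v)]
  (S₀ : Finset (HeightOneSpectrum (𝓞 F))) {i₀ : HeightOneSpectrum (𝓞 F)} (hi₀ : i₀ ∈ S₀)
  (hB1 : ∀ v, v ∉ S₀ → ν v (UnitaryGroup.localInt E c N J v : Set (UnitaryGroup.localPi E c N J v)) = 1)

include hi₀ hB1 in
/-- **EULER FACTORISATION over `U(J)(𝔸_{F,f}) = Πʳ_v [U(J)(F_v), U(J)(𝒪_v)]`** (Leahy 3.1.8–3.1.9 ∕ Tate 3.3.1 through the HodgeCM∕PerL34 kernel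
engine, transported along ★ `UnitaryGroup.finAdelicEquiv`): let `μ_f` be any Haar measure on `U(J)(𝔸_{F,f})`, `ν_v` local Haar measures with
`ν_v(U(J)(𝒪_v)) = 1` off a finite `S₀ ∋ i₀`, and `f` an integrand on `U(J)(𝔸_{F,f})` which is a PURE TENSOR off `T`: on every principal level
`S ⊇ T`, `f(e⁻¹(glue_S(x, k))) = ∏_{v∈S} f_v(x_v)` for `x ∈ Π_{v∈S} U(J)(F_v)`, `k ∈ Π_{v∉S} U(J)(𝒪_v)` (so `f_v ≡ 1` on `U(J)(𝒪_v)` off `T`),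
with integrable local factors and bounded partial products of `∫‖f_v‖`.  Then, for ONE constant `κ > 0` (the Haar normalisation of `μ_f`
against `⊗ ν_v`, absorbed at the place `i₀`),
**`∫_{U(J)(𝔸_{F,f})} f dμ_f = ∏'_v ∫_{U(J)(F_v)} f_v d(ν rescaled at i₀ by κ)_v`** — the finite-place half of [Li1992, (27)].
[cite: Li1992, Thm 2.1 (27) p. 184] [cite: TateThesis1967, Thm 3.3.1] [cite: PlatonovRapinchuk1994, §5.1] -/
theorem exists_integral_finAdelic_eq_tprod :
    ∃ κ : ℝ≥0, 0 < κ ∧ ∀ {f : UnitaryGroup.finAdelic F E c N J → ℂ} {fl : ∀ v, UnitaryGroup.localPi E c N J v → ℂ}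
      {T : Finset (HeightOneSpectrum (𝓞 F))},
      (∀ S : Finset (HeightOneSpectrum (𝓞 F)), T ⊆ S →
        ∀ x : ((v : ↥S) → UnitaryGroup.localPi E c N J v) ×
            ((v : {v // v ∉ S}) → (UnitaryGroup.localInt E c N J v : Set (UnitaryGroup.localPi E c N J v))),
          f ((UnitaryGroup.finAdelicEquiv F E c N J).symm
            (RestrictedMeasure.glue (fun v => (UnitaryGroup.localInt E c N J v : Set (UnitaryGroup.localPi E c N J v))) S x)) =
            ∏ v : ↥S, fl v.1 (x.1 v)) →
      AEStronglyMeasurable f μf → (∀ v, Integrable (fl v) (ν v)) →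
      (∃ B : ℝ, ∀ S : Finset (HeightOneSpectrum (𝓞 F)), S₀ ⊆ S → T ⊆ S → ∏ v ∈ S, ∫ x, ‖fl v x‖ ∂ν v ≤ B) →
      ∫ b, f b ∂μf = ∏' v, ∫ x, fl v x ∂(Function.update ν i₀ (κ • ν i₀) v) := by
  haveI : Countable (HeightOneSpectrum (𝓞 F)) := countable_heightOneSpectrum F
  haveI : ∀ v, LocallyCompactSpace (UnitaryGroup.localPi E c N J v) := fun v => locallyCompactSpace_localPi F E c N J v
  haveI : ∀ v, SecondCountableTopology (UnitaryGroup.localPi E c N J v) :=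
    fun v => secondCountableTopology_localPi F E c N J v
  have hKo : ∀ v : HeightOneSpectrum (𝓞 F), IsOpen (UnitaryGroup.localInt E c N J v : Set (UnitaryGroup.localPi E c N J v)) :=
    Fact.out
  have hKm : ∀ v, MeasurableSet (UnitaryGroup.localInt E c N J v : Set (UnitaryGroup.localPi E c N J v)) :=
    fun v => (hKo v).measurableSet
  haveI := RestrictedMeasure.borelSpace
    (K := fun v => (UnitaryGroup.localInt E c N J v : Set (UnitaryGroup.localPi E c N J v))) hKm
  -- the transported Haar measure `μ' = e_* μ_f` is σ-finite and left invariant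
  haveI := UnitaryGroup.locallyCompactSpace_finAdelic F E c N J
  haveI := UnitaryGroup.secondCountableTopology_finAdelic F E c N J
  haveI : SigmaCompactSpace (UnitaryGroup.finAdelic F E c N J) := sigmaCompactSpace_of_locallyCompact_secondCountable
  haveI : SigmaFinite μf := inferInstance
  set e := UnitaryGroup.finAdelicEquiv F E c N J with he
  have hcoe : (e.toHomeomorph.toMeasurableEquiv : UnitaryGroup.finAdelic F E c N J → _) = e := Homeomorph.toMeasurableEquiv_coe _
  haveI : SigmaFinite (μf.map e) := by
    rw [← hcoe]; exact e.toHomeomorph.toMeasurableEquiv.sigmaFinite_map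
  haveI hHaar : (μf.map e).IsHaarMeasure := e.toMulEquiv.isHaarMeasure_map μf e.continuous e.symm.continuous
  let C : ∀ v : HeightOneSpectrum (𝓞 F), TopologicalSpace.PositiveCompacts (UnitaryGroup.localPi E c N J v) := fun v =>
    { carrier := (UnitaryGroup.localInt E c N J v : Set (UnitaryGroup.localPi E c N J v))
      isCompact' := UnitaryGroup.isCompact_localInt E c N J v
      interior_nonempty' := ⟨1, by rw [(hKo v).interior_eq]; exact one_mem _⟩ }
  -- the datum: measure `e_* μ_f`, exceptional set `S₀`, levels = glue, local measures `ν` rescaled at `i₀`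
  let D := RestrictedProductMeasureDatum.ofLeftInvariant (fun v => UnitaryGroup.localInt E c N J v) S₀ C ν
      (fun v _ => UnitaryGroup.isCompact_localInt E c N J v) hB1 hi₀ (μf.map e)
  set κ : ℝ≥0 := RestrictedMeasure.haarScalar (fun v => UnitaryGroup.localInt E c N J v) S₀ C ν (μf.map e) with hκ
  have hDμ : D.μ = μf.map e := rfl
  have hDν : D.ν = Function.update ν i₀ (κ • ν i₀) := rfl
  have hDS₀ : D.S₀ = S₀ := rfl
  refine ⟨κ, ?_, fun {f} {fl} {T} hpure hfm hfl hB => ?_⟩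
  · -- `κ = μ'(K₀) / ∏_{v ∈ S₀} ν_v(C_v) > 0`: `μ' = e_* μ_f` is a Haar measure, positive on the reference box `K₀` (non-empty interior)
    have hBc : ∀ v, v ∉ S₀ → IsCompact (UnitaryGroup.localInt E c N J v : Set (UnitaryGroup.localPi E c N J v)) :=
      fun v _ => UnitaryGroup.isCompact_localInt E c N J v
    have hfin := RestrictedMeasure.measure_haarBox_ne_top (fun v => UnitaryGroup.localInt E c N J v) S₀ C hBc (μf.map e)
    have hpos : (μf.map e) (RestrictedMeasure.haarBox (fun v => UnitaryGroup.localInt E c N J v) S₀ C) ≠ 0 :=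
      (Measure.measure_pos_of_nonempty_interior (μf.map e)
        (RestrictedMeasure.haarCompacts (fun v => UnitaryGroup.localInt E c N J v) S₀ C hBc).interior_nonempty).ne'
    rw [hκ]
    exact ENNReal.toNNReal_pos (mul_ne_zero hpos (ENNReal.inv_ne_zero.2 (RestrictedMeasure.prod_haar_ne_top S₀ C ν)))
      (ENNReal.mul_ne_top hfin (ENNReal.inv_ne_top.2 (RestrictedMeasure.prod_haar_ne_zero S₀ C ν)))
  · have h1 : ∫ b, f b ∂μf = ∫ a, (f ∘ e.symm) a ∂(μf.map e) := by
      rw [← hcoe, integral_map_equiv]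
      refine integral_congr_ae (Filter.Eventually.of_forall fun b => ?_)
      simp only [Function.comp_apply, hcoe, ContinuousMulEquiv.symm_apply_apply]
    have hfm' : AEStronglyMeasurable (f ∘ e.symm) (μf.map e) := by
      rw [← hcoe, (e.toHomeomorph.toMeasurableEquiv.measurableEmbedding).aestronglyMeasurable_map_iff]
      have hcomp : (f ∘ ⇑e.symm) ∘ ⇑(e.toHomeomorph.toMeasurableEquiv) = f := by
        funext b
        simp only [Function.comp_apply, hcoe, ContinuousMulEquiv.symm_apply_apply]
      rw [hcomp]
      exact hfm
    have hpure' : D.IsPureTensor T (f ∘ e.symm) fl := fun S hS x => hpure S hS x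
    have hfl' : ∀ v, Integrable (fl v) (D.ν v) := by
      intro v
      rw [hDν]
      by_cases hv : v = i₀
      · subst hv
        rw [Function.update_self]
        exact (hfl v).smul_measure ENNReal.coe_ne_top
      · rw [Function.update_of_ne hv]
        exact hfl v
    have hB' : ∃ B : ℝ, ∀ S : Finset (HeightOneSpectrum (𝓞 F)), D.S₀ ⊆ S → T ⊆ S →
        ∏ v ∈ S, ∫ x, ‖fl v x‖ ∂D.ν v ≤ B := by
      obtain ⟨B, hB⟩ := hB
      refine ⟨(κ : ℝ) * B, fun S hS hT => ?_⟩
      have hi : i₀ ∈ S := hS hi₀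
      have herase : ∏ v ∈ S.erase i₀, ∫ x, ‖fl v x‖ ∂(Function.update ν i₀ (κ • ν i₀) v) =
          ∏ v ∈ S.erase i₀, ∫ x, ‖fl v x‖ ∂ν v :=
        Finset.prod_congr rfl fun v hv => by rw [Function.update_of_ne (Finset.ne_of_mem_erase hv)]
      rw [hDν, ← Finset.mul_prod_erase S _ hi, Function.update_self, integral_smul_nnreal_measure, herase, NNReal.smul_def,
        smul_eq_mul, mul_assoc, Finset.mul_prod_erase S (fun v => ∫ x, ‖fl v x‖ ∂ν v) hi]
      exact mul_le_mul_of_nonneg_left (hB S hS hT) κ.coe_nonneg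
    rw [h1]
    have h2 := integral_eq_tprod hpure' hfm' hfl' hB'
    rw [hDμ, hDν] at h2
    exact h2

end Datum

end Summit.HodgeConjecture.HodgeConjecture.Cruxes.H413.ThetaNonvanishing

end
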